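import Literature.AlgebraicGeometry.GroupSchemes.FullSetOfSections
import Mathlib.LinearAlgebra.Charpoly.BaseChange
import Mathlib.Algebra.Polynomial.BigOperators
import Mathlib.Algebra.MvPolynomial.Eval
import Mathlib.RingTheory.Ideal.Maps
import HarnessLib

/-!
# Full sets of sections — criteria: the characteristic-polynomial form, the generic element, and Katz–Mazur's
# Lemma 1.9.1 (the «full set» locus is closed)

Topic `AlgebraicGeometry/GroupSchemes`; namespace `Literature.AlgebraicGeometry.GroupSchemes`; continues ★
`FullSetOfSections` (p844334: the NORM form `IsFullSetOfSections`, [KatzMazur1985, §1.8 (1.8.2)]).  Fully proved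
theorems only: **no def, no named fact, no `sorry`, no instance, no notation**.  Cell `pub/hodgecm-mathlib`,
programme P6 («MOD»), generic organ L5.1 (file 2).

## Mathematics

Let `Z = Spec A → S = Spec R` with `A` finite free over `R`, and `P₁, …, P_N ∈ Z(S)`.
* [KatzMazur1985, §1.8] gives two equivalent forms of «the `Pᵢ` form a full set of sections»: for every `T → S` and
  `f ∈ Γ(Z_T, 𝒪)`, (1) the characteristic polynomial of `f·` on `𝒪_{Z_T}` is `∏ᵢ (X − f(Pᵢ))`; (2)
  `Norm_{Z_T/T}(f) = ∏ᵢ f(Pᵢ)`.  (1) ⇒ (2) is the constant coefficient; (2) ⇒ (1) is (2) over `T ×_ℤ 𝔸¹` applied to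
  `X − f`, whose norm IS the characteristic polynomial (§5).
* [KatzMazur1985, Lemma 1.9.1]: the condition is represented by a closed subscheme of `S` — in a basis `(e_j)` of `A`
  every `f` is a specialisation of the GENERIC ELEMENT `ξ = ∑ X_j ⊗ e_j ∈ R[X_j] ⊗_R A`, so (2) for all `T` is the
  single polynomial identity `Norm(ξ) = ∏ᵢ Pᵢ(ξ)` in `R[X_j : j]`, whose finitely many coefficients generate an
  ideal `I ⊆ R` with «`(P_{i,R′})` full ⇔ `I R′ = 0`» for every `R → R′` (§6).

## Contents
* §5 `norm_algebraMap_X_sub_one_tmul` (`Norm_{K[X] ⊗_K B/K[X]}(X·1 − 1 ⊗ g) = charpoly(g·)` for `B` finite free over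
  `K`; Mathlib `Algebra.baseChange_lmul`, `LinearMap.toMatrix_baseChange`, `Matrix.charmatrix`) and
  **`isFullSetOfSections_iff_charpoly_eq`** (NORM form ⇔ CHARACTERISTIC-POLYNOMIAL form, `A` finite free).
* §6 `norm_map_baseChange` (norms commute with base change along `R`-algebra maps `S₁ → S₂`, `A` finite free),
  **`isFullSetOfSections_iff_generic`** (fullness ⇔ the norm identity for the generic element),
  **`exists_fg_ideal_isFullSetOfSections_baseChange_iff`** (Lemma 1.9.1, affine form: a finitely generated ideal
  `I ⊆ R` with `(P_{i,R′})` full ⇔ `I·R′ = 0` for all `R′`), `isFullSetOfSections_iff_baseChange_self`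
  (`(Pᵢ)` full ⇔ `(P_{i,R})` full), **`IsFullSetOfSections.of_baseChange_of_injective`** (fullness DESCENDS along
  injective `R → R′`).
* §7 `isFullSetOfSections_of_bijective_pi` — if `a ↦ (Pⱼ a)ⱼ : A → R^J` is bijective (the `Pⱼ` split `Spec A` as the
  trivial cover) then `(Pⱼ)` is full (transport of ★ `isFullSetOfSections_piEval`).

What is deliberately NOT here: locally free (non-free) `A` (apply Zariski-locally on `R`), the Cartier-divisor form
[KatzMazur1985, Thm. 1.10.1], closed subschemes defined by full sets of sections [KatzMazur1985, Cor. 1.10.3], the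
representability of Drinfeld level structures [HarrisTaylorAMS2001, Lemma II.2.1 (6)] (group-scheme side, P6c).
HC_CM is proved only modulo the printed citations until rung 0 closes; this file changes no count.

## References
* [KatzMazur1985] N. M. Katz, B. Mazur, *Arithmetic Moduli of Elliptic Curves*, Ann. of Math. Stud. 108 (1985), §1.8
  (1.8.2), Lemma 1.9.1.
* [HarrisTaylorAMS2001] M. Harris, R. Taylor, *The Geometry and Cohomology of Some Simple Shimura Varieties*, Ann. of
  Math. Stud. 151 (2001), Lemma II.2.1 (1), (6) and their proofs («proposition 1.9.1 ∕ lemma 1.9.1 of [KM]»).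
-/

set_option autoImplicit false

noncomputable section

open scoped TensorProduct

universe u

/-! ## §5 The characteristic-polynomial form (Katz–Mazur's condition (1)) -/

namespace Literature.AlgebraicGeometry.GroupSchemes

open Polynomial in
/-- **`Norm_{K[X] ⊗_K B / K[X]}(X − g)` is the characteristic polynomial of `g·`** for a finite free `K`-algebra `B`:
in the base-changed basis `1 ⊗ bᵢ` the matrix of multiplication by `X·1 − 1 ⊗ g` on `K[X] ⊗_K B` is the characteristic
matrix `X·I − (g·)` of the matrix of `g·` in the basis `bᵢ` (the device by which the norm form of «full set of sections»
after the base change `K → K[X]` yields the characteristic-polynomial form). [cite: KatzMazur1985, §1.8 (1.8.2)] -/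
theorem norm_algebraMap_X_sub_one_tmul {K B : Type*} [CommRing K] [CommRing B] [Algebra K B]
    [Module.Free K B] [Module.Finite K B] (g : B) :
    Algebra.norm K[X] (algebraMap K[X] (K[X] ⊗[K] B) X - (1 : K[X]) ⊗ₜ[K] g) = (Algebra.lmul K B g).charpoly := by
  classical
  let b := Module.Free.chooseBasis K B
  rw [Algebra.norm_eq_matrix_det (Algebra.TensorProduct.basis K[X] b),
    ← LinearMap.charpoly_toMatrix _ b, Matrix.charpoly]
  congr 1
  rw [map_sub, AlgHom.commutes, Matrix.algebraMap_eq_diagonal, Matrix.charmatrix, RingHom.mapMatrix_apply,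
    Matrix.scalar_apply, Algebra.leftMulMatrix_apply, ← Algebra.baseChange_lmul, LinearMap.toMatrix_baseChange,
    Polynomial.algebraMap_eq]
  rfl

variable {R A : Type u} [CommRing R] [CommRing A] [Algebra R A]

open Polynomial in
/-- **Katz–Mazur's two forms of «full set of sections» agree** for `A` finite free over `R`: the NORM form
(`IsFullSetOfSections`: `Norm(g) = ∏ᵢ g(Pᵢ)` after every base change) holds iff the CHARACTERISTIC-POLYNOMIAL form holds
(after every base change `R → R′` and for every `g ∈ R′ ⊗_R A`, `det(X − g·) = ∏ᵢ (X − g(P_{i,R′}))`).  (⇒): apply the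
norm form over `R′[X]` to `X·1 − g` and read it through `R′[X] ⊗_R A ≅ R′[X] ⊗_{R′} (R′ ⊗_R A)`
(`norm_algebraMap_X_sub_one_tmul`, `AlgHom.pointBaseChange_cancelBaseChange`); (⇐): the norm is `(−1)^n` times the
constant coefficient of the characteristic polynomial, and comparing degrees gives `n = |J|` over a nontrivial `R′`.
[cite: KatzMazur1985, §1.8 (1.8.2)] -/
theorem isFullSetOfSections_iff_charpoly_eq [Module.Free R A] [Module.Finite R A] {J : Type} [Fintype J]
    (P : J → (A →ₐ[R] R)) :
    IsFullSetOfSections P ↔ ∀ (R' : Type u) [CommRing R'] [Algebra R R'] (g : R' ⊗[R] A),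
      (Algebra.lmul R' (R' ⊗[R] A) g).charpoly = ∏ i, (X - C ((P i).pointBaseChange R' g)) := by
  classical
  constructor
  · intro hP R' _ _ g
    have h := hP R'[X] (Algebra.TensorProduct.cancelBaseChange R R' R'[X] R'[X] A
      (algebraMap R'[X] (R'[X] ⊗[R'] (R' ⊗[R] A)) X - (1 : R'[X]) ⊗ₜ[R'] g))
    rw [Algebra.norm_eq_of_algEquiv, norm_algebraMap_X_sub_one_tmul] at h
    rw [h]
    refine Finset.prod_congr rfl fun i _ => ?_
    rw [AlgHom.pointBaseChange_cancelBaseChange, map_sub, AlgHom.commutes, Algebra.algebraMap_self,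
      RingHom.id_apply, AlgHom.pointBaseChange_tmul, one_mul, Polynomial.algebraMap_eq]
  · intro h R' _ _ _ g
    rcases subsingleton_or_nontrivial R' with hR' | hR'
    · exact Subsingleton.elim _ _
    have hg := h R' g
    -- degrees: `finrank_{R′}(R′ ⊗ A) = |J|`
    have hn : Module.finrank R' (R' ⊗[R] A) = Fintype.card J := by
      have hd := congr_arg Polynomial.natDegree hg
      rwa [LinearMap.charpoly_natDegree, Polynomial.natDegree_prod_of_monic _ _ fun i _ => monic_X_sub_C _,
        Finset.sum_congr rfl fun i _ => natDegree_X_sub_C _, Finset.sum_const, smul_eq_mul, mul_one,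
        Finset.card_univ] at hd
    -- the constant coefficient
    have h0 : (∏ i, (X - C ((P i).pointBaseChange R' g))).coeff 0 =
        (-1) ^ Fintype.card J * ∏ i, (P i).pointBaseChange R' g := by
      rw [Polynomial.coeff_zero_eq_eval_zero, Polynomial.eval_prod]
      simp_rw [eval_sub, eval_X, eval_C, zero_sub, ← neg_one_mul ((P _).pointBaseChange R' g),
        Finset.prod_mul_distrib, Finset.prod_const, Finset.card_univ]
    rw [Algebra.norm_apply, LinearMap.det_eq_sign_charpoly_coeff, hg, h0, hn, ← mul_assoc, ← pow_add,
      ← two_mul, pow_mul, neg_one_sq, one_pow, one_mul]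

end Literature.AlgebraicGeometry.GroupSchemes


/-! ## §6 The generic element: Katz–Mazur's Lemma 1.9.1 (the «full set of sections» locus is closed) -/

namespace Literature.AlgebraicGeometry.GroupSchemes

section Generic

variable {R A : Type u} [CommRing R] [CommRing A] [Algebra R A]

/-- **Norms commute with base change along ring maps** (for `A` finite free over `R`): for an `R`-algebra map
`φ : S₁ → S₂` and `x ∈ S₁ ⊗_R A`, `Norm_{S₂ ⊗ A / S₂}((φ ⊗ id) x) = φ (Norm_{S₁ ⊗ A / S₁}(x))` — in the base-changed
bases `1 ⊗ bᵢ` the matrix of `(φ ⊗ id) x ·` is `φ` applied entrywise to the matrix of `x·`.  (The base-change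
compatibility of norms underlying [KatzMazur1985, §1.8].) [cite: KatzMazur1985, §1.8 (1.8.2)] -/
theorem norm_map_baseChange [Module.Free R A] [Module.Finite R A] {S₁ S₂ : Type*} [CommRing S₁] [CommRing S₂]
    [Algebra R S₁] [Algebra R S₂] (φ : S₁ →ₐ[R] S₂) (x : S₁ ⊗[R] A) :
    Algebra.norm S₂ (Algebra.TensorProduct.map φ (AlgHom.id R A) x) = φ (Algebra.norm S₁ x) := by
  classical
  let b := Module.Free.chooseBasis R A
  have hrepr : ∀ (y : S₁ ⊗[R] A) (i : Module.Free.ChooseBasisIndex R A),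
      (Algebra.TensorProduct.basis S₂ b).repr (Algebra.TensorProduct.map φ (AlgHom.id R A) y) i =
        φ ((Algebra.TensorProduct.basis S₁ b).repr y i) := by
    intro y i
    induction y using TensorProduct.induction_on with
    | zero => simp
    | add y z hy hz => simp [hy, hz]
    | tmul s a =>
      simp [Algebra.TensorProduct.basis_repr_tmul, AlgHom.commutes]
  rw [Algebra.norm_eq_matrix_det (Algebra.TensorProduct.basis S₂ b),
    Algebra.norm_eq_matrix_det (Algebra.TensorProduct.basis S₁ b), AlgHom.map_det]
  congr 1
  ext i j
  have hj : Algebra.TensorProduct.basis S₂ b j =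
      Algebra.TensorProduct.map φ (AlgHom.id R A) (Algebra.TensorProduct.basis S₁ b j) := by
    rw [Algebra.TensorProduct.basis_apply, Algebra.TensorProduct.basis_apply, Algebra.TensorProduct.map_tmul,
      map_one, AlgHom.id_apply]
  rw [Algebra.leftMulMatrix_eq_repr_mul, AlgHom.mapMatrix_apply, Matrix.map_apply,
    Algebra.leftMulMatrix_eq_repr_mul, hj, ← map_mul, hrepr]

variable {ι : Type} [Fintype ι] {J : Type} [Fintype J]

open MvPolynomial in
/-- **The generic element decides fullness.**  If `A` has a finite `R`-basis `(e_j)_{j ∈ ι}`, then `(Pᵢ)` is a full set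
of sections iff the norm identity holds for the ONE element `ξ = ∑ⱼ X_j ⊗ e_j` of `R[X_j : j ∈ ι] ⊗_R A` (the generic
element of `A`): every `g = ∑ c_j (1 ⊗ e_j) ∈ R′ ⊗_R A` is the image of `ξ` under the base change
`R[X] → R′, X_j ↦ c_j`, and both the norm (`norm_map_baseChange`) and the values at the points
(`AlgHom.map_pointBaseChange`) follow.  (The universal-identity reading of [KatzMazur1985, §1.8–§1.9].)
[cite: KatzMazur1985, Lemma 1.9.1] -/
theorem isFullSetOfSections_iff_generic (e : Module.Basis ι R A) (P : J → (A →ₐ[R] R)) :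
    IsFullSetOfSections P ↔
      Algebra.norm (MvPolynomial ι R) (∑ j, (X j : MvPolynomial ι R) ⊗ₜ[R] e j) =
        ∏ i, (P i).pointBaseChange (MvPolynomial ι R) (∑ j, (X j : MvPolynomial ι R) ⊗ₜ[R] e j) := by
  haveI : Module.Free R A := Module.Free.of_basis e
  haveI : Module.Finite R A := Module.Finite.of_basis e
  constructor
  · intro hP
    exact hP (MvPolynomial ι R) _
  · intro h R' _ _ _ g
    classical
    -- `g` is the specialisation of the generic element at its coordinates `c`
    set c : ι → R' := fun j => (Algebra.TensorProduct.basis R' e).repr g j with hc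
    have hg : Algebra.TensorProduct.map (aeval c) (AlgHom.id R A)
        (∑ j, (X j : MvPolynomial ι R) ⊗ₜ[R] e j) = g := by
      rw [map_sum]
      simp_rw [Algebra.TensorProduct.map_tmul, aeval_X, AlgHom.id_apply]
      conv_rhs => rw [← (Algebra.TensorProduct.basis R' e).sum_repr g]
      simp_rw [Algebra.TensorProduct.basis_repr_symm_apply', hc]
    rw [← hg, norm_map_baseChange, h, map_prod]
    exact Finset.prod_congr rfl fun i _ => (P i).map_pointBaseChange (aeval c) _

open MvPolynomial in
/-- **Katz–Mazur's Lemma 1.9.1 (affine form, `A` free with a finite basis): the condition «the `P_{i,R′}` form a full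
set of sections» is represented by a closed subscheme of `Spec R` cut out by finitely many equations.**  There is a
finitely generated ideal `I ⊆ R` — generated by the coefficients of
`Norm(ξ) − ∏ᵢ P_{i}(ξ) ∈ R[X_j : j ∈ ι]`, `ξ` the generic element — such that for EVERY `R`-algebra `R′`, the base
changed points `(P_{i,R′})` form a full set of sections of `Spec (R′ ⊗_R A) → Spec R′` iff `I·R′ = 0`.
[cite: KatzMazur1985, Lemma 1.9.1] -/
theorem exists_fg_ideal_isFullSetOfSections_baseChange_iff (e : Module.Basis ι R A) (P : J → (A →ₐ[R] R)) :
    ∃ I : Ideal R, I.FG ∧ ∀ (R' : Type u) [CommRing R'] [Algebra R R'],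
      IsFullSetOfSections (fun i => (P i).pointBaseChange R') ↔ Ideal.map (algebraMap R R') I = ⊥ := by
  classical
  haveI : Module.Free R A := Module.Free.of_basis e
  haveI : Module.Finite R A := Module.Finite.of_basis e
  -- the generic element and the universal defect
  set ξ : MvPolynomial ι R ⊗[R] A := ∑ j, (X j : MvPolynomial ι R) ⊗ₜ[R] e j with hξ
  set D : MvPolynomial ι R :=
    Algebra.norm (MvPolynomial ι R) ξ - ∏ i, (P i).pointBaseChange (MvPolynomial ι R) ξ with hD
  refine ⟨Ideal.span (D.coeffs : Set R), ⟨D.coeffs, rfl⟩, fun R' _ _ => ?_⟩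
  -- abbreviations over `R′`
  let T := MvPolynomial ι R'
  let ψ : MvPolynomial ι R →ₐ[R] T := mapAlgHom (Algebra.ofId R R')
  have hψ : ∀ p : MvPolynomial ι R, ψ p = MvPolynomial.map (algebraMap R R') p := fun p => rfl
  -- (1) the generic criterion over `R′`, for the base-changed basis
  rw [isFullSetOfSections_iff_generic (Algebra.TensorProduct.basis R' e)]
  -- (2) move along `T ⊗[R′] (R′ ⊗[R] A) ≅ T ⊗[R] A`: the generic element goes to `(ψ ⊗ id) ξ`
  have hκ : Algebra.TensorProduct.cancelBaseChange R R' T T A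
      (∑ j, (X j : T) ⊗ₜ[R'] Algebra.TensorProduct.basis R' e j) =
        Algebra.TensorProduct.map ψ (AlgHom.id R A) ξ := by
    rw [hξ, map_sum, map_sum]
    refine Finset.sum_congr rfl fun j _ => ?_
    rw [Algebra.TensorProduct.basis_apply, Algebra.TensorProduct.cancelBaseChange_tmul, one_smul,
      Algebra.TensorProduct.map_tmul, AlgHom.id_apply, mapAlgHom_apply, map_X]
  have hnorm : Algebra.norm T (∑ j, (X j : T) ⊗ₜ[R'] Algebra.TensorProduct.basis R' e j) =
      ψ (Algebra.norm (MvPolynomial ι R) ξ) := by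
    rw [← Algebra.norm_eq_of_algEquiv (Algebra.TensorProduct.cancelBaseChange R R' T T A), hκ,
      norm_map_baseChange]
  have hpt : ∀ i, ((P i).pointBaseChange R').pointBaseChange T
      (∑ j, (X j : T) ⊗ₜ[R'] Algebra.TensorProduct.basis R' e j) =
        ψ ((P i).pointBaseChange (MvPolynomial ι R) ξ) := by
    intro i
    rw [← AlgHom.pointBaseChange_cancelBaseChange, hκ, AlgHom.map_pointBaseChange]
  rw [hnorm, Finset.prod_congr rfl fun i _ => hpt i, ← map_prod, ← sub_eq_zero, ← map_sub, ← hD]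
  -- (3) `ψ D = 0` iff every coefficient of `D` dies in `R′`
  rw [hψ, Ideal.map_span, Ideal.span_eq_bot]
  constructor
  · intro h0 x hx
    obtain ⟨c, hc, rfl⟩ := hx
    obtain ⟨n, -, rfl⟩ := mem_coeffs_iff.mp hc
    have := congr_arg (MvPolynomial.coeff n) h0
    rwa [coeff_map, coeff_zero] at this
  · intro h0
    ext n
    rw [coeff_map, coeff_zero]
    by_cases hn : D.coeff n = 0
    · rw [hn, map_zero]
    · exact h0 _ ⟨_, coeff_mem_coeffs n hn, rfl⟩

/-- The points `P_{i,R}` over `R` itself are the `Pᵢ` read through `R ⊗_R A ≅ A`; hence `(Pᵢ)` is a full set of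
sections iff `(P_{i,R})` is. [cite: KatzMazur1985, §1.8 (1.8.2)] -/
theorem isFullSetOfSections_iff_baseChange_self (P : J → (A →ₐ[R] R)) :
    IsFullSetOfSections P ↔ IsFullSetOfSections fun i => (P i).pointBaseChange R := by
  refine ⟨fun hP => hP.baseChange R, fun hP => ?_⟩
  have h := hP.of_algEquiv (Algebra.TensorProduct.lid R A)
  convert h using 2 with i
  ext a
  simp [Algebra.TensorProduct.lid_symm_apply]

/-- **Fullness descends along injective ring maps** (`A` free with a finite basis): if `R → R′` is injective and the
base-changed points `(P_{i,R′})` form a full set of sections, then so do the `(Pᵢ)` — the defining equations of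
Lemma 1.9.1 have coefficients in `R` and vanish in `R′`. [cite: KatzMazur1985, Lemma 1.9.1] -/
theorem IsFullSetOfSections.of_baseChange_of_injective (e : Module.Basis ι R A) {P : J → (A →ₐ[R] R)}
    (R' : Type u) [CommRing R'] [Algebra R R'] (hinj : Function.Injective (algebraMap R R'))
    (hP : IsFullSetOfSections fun i => (P i).pointBaseChange R') : IsFullSetOfSections P := by
  obtain ⟨I, -, hI⟩ := exists_fg_ideal_isFullSetOfSections_baseChange_iff e P
  rw [isFullSetOfSections_iff_baseChange_self, hI, Algebra.algebraMap_self, Ideal.map_id, eq_bot_iff]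
  have h' := (hI R').mp hP
  intro x hx
  have hx' : algebraMap R R' x ∈ Ideal.map (algebraMap R R') I := Ideal.mem_map_of_mem _ hx
  rw [h'] at hx'
  exact (Submodule.mem_bot R).mpr (hinj (by rw [(Submodule.mem_bot R').mp hx', map_zero]))

end Generic

end Literature.AlgebraicGeometry.GroupSchemes

/-! ## §7 The étale (split) case: sections inducing `A ≅ R^J` -/

namespace Literature.AlgebraicGeometry.GroupSchemes

variable {R A : Type u} [CommRing R] [CommRing A] [Algebra R A] {J : Type} [Fintype J] [DecidableEq J]

/-- **Sections that split the algebra form a full set.**  If the joint evaluation `A → R^J`, `a ↦ (Pⱼ a)ⱼ` is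
bijective — i.e. `Spec A = ∐_J S` is the trivial cover with the `Pⱼ` its canonical sections (the situation of a full
level structure on a finite ÉTALE scheme after an étale base change) — then `(Pⱼ)` is a full set of sections
(transport of ★ `isFullSetOfSections_piEval` along `A ≃ₐ[R] (J → R)`). [cite: KatzMazur1985, §1.8 (1.8.2)] -/
theorem isFullSetOfSections_of_bijective_pi (P : J → (A →ₐ[R] R))
    (h : Function.Bijective (AlgHom.pi P : A →ₐ[R] (J → R))) : IsFullSetOfSections P := by
  have hfull := (isFullSetOfSections_piEval (R := R) J).of_algEquiv (AlgEquiv.ofBijective _ h).symm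
  convert hfull using 2 with j
  ext a
  simp [AlgHom.pi_apply]

end Literature.AlgebraicGeometry.GroupSchemes

end
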